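import Summits.QuantumFields.BalabanUV.Beta.GAN24.W3SourceRowsBorder

/-!
# `BalabanUV.Beta.GAN24.W3SourceRowsEnd` — ROWS W3-F4a ∕ W3-F4b OF SKELETON-W3 §8.3 IN THE LITERAL INSTANTIATION OF THE TREE ENDs
# (`WSlotT2OfPieces.t2Shape_of_rows` ∕ `t2Drift_of_rows`, base-root border `vh₂S d Lc`): the END binders `hb` ∕ `hf` at `mom := fun _ ↦ 0`
# (RULINGS-14 (R14-3), ref2 R57-2 (b)) for EVERY admissible input rate `δin ≤ δ*` (referee (w8) ∕ R57-3 (w10′)), so that F4a ∕ F4b plug into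
# END #1 ∕ END #2 BY NAME (G-an2-4 formalisation swarm, leaf prover 08, gen 19; sequel of `GAN24/W3SourceRowsBorder`; journal INTENT
# «W3-F4AB-BORDER*»; name PROVISIONAL)

NOT IN PRINT; OUR PROOF ATTEMPT (composition of tree theorems).  HONEST FRAMING (cell contract, verbatim): «discharging `BetaPertH` makes
Bałaban's UV stability UNCONDITIONAL — a real constructive-QFT result; it is NOT the continuum limit and NOT the Clay problem.»  HONEST
DEPENDENCY (verbatim): «continuum YM on T⁴ ⇐ BetaPertH ∧ nine spine estimates (0/9 proved); BetaPertH ⇐ (D1) ∧ (D4) ∧ CAP+tail; G-an2-4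
gates asym, D1 and NE2/3/4.»

WHAT.  Referee r57 lists `hb` (F4a) among the residual binders of «T2Shape» (END #1) and `hf` (F4b) among those of «T2Drift» (END #2), and
rules (R57-3 (w10′)) that END #3's difference tower carries its OWN input rate `δin′`, chosen AFTER END #1's output, at which `hf` must deliver.
The tree ENDs (p213240) are written at an1's BASE-root border `vh₂S d Lc` with a generic mixed table `mixFF`; this module is
`W3SourceRowsBorder.hb_border` ∕ `hf_border` at exactly that border (`hB` discharged by leaf-19's `T2SlotUnits.locStencil₂_vh₂S`):
* §1 generic `d`, `1 ≤ Lc`: **`hb_base`** (ROW W3-F4a; left: K-slot decay half, «E3Shape», the mixFF shape), **`hf_base`** (ROW W3-F4b; left: the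
  K-slot rows, «E3Shape» ∧ «E3Drift», the mixFF shape and the tower shape `hx` = «T2Shape», END #1's OUTPUT — ref2 R53-3);
* §2 `d = 3`, `2 ≤ Lc`: **`hb_three`**, **`hf_three`** — K-slot by `KSlotAssembly.convCKWall_holds`, S-slot by `SpureUnitDrift.e3ShapeDrift_three`
  BY NAME; residual hypotheses = the mixFF shape with ff-support (`hmix`∕`hδ₄`∕`hfm`∕`hm`, = ROWS-MIX, discharged for an1's `mixFFAt` by
  `WSlotMixedShape` ∕ `MixedJetTablesPlug.hmix_an1`) (+ `hx`, `hδ₂` for `hf_three`).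
Conclusions: `∃ Cb δ*, 0 ≤ Cb ∧ 0 < δ* ∧ ∀ ⦃δin⦄, δin ≤ δ* → ∀ m, LocStencil₂ (b♮ m) Cb δin ∧ 0 ≤ Cb` and
`∃ Cf θ δ*, 0 ≤ Cf ∧ 0 ≤ θ ∧ θ < 1 ∧ 0 < δ* ∧ ∀ ⦃δin⦄, δin ≤ δ* → ∀ m, LocStencil₂ (f m) (Cf·θ^m) δin ∧ 0 ≤ Cf·θ^m` with `b♮`, `f` the LITERAL texts
of leaf-01's F1a∕F1b (`T2UnitSplitShapes.unitS₂_T2Of_eq_transport_add_sum_vh₂S_of_mix` ∕ `…_sub_…`) at a generic tower `x` (`lin4` BY NAME) — for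
`δin ≤ δ*` the inner statement IS the END's `hb` ∕ `hf` at `mom := fun _ ↦ 0` (second conjunct by `rfl`).

HONEST: [folklore] composition; instantiates NO wall binder by itself, asserts nothing about «T2Shape»∕«T2SupRate» (OPEN, NOT IN PRINT),
discharges NOTHING of (hW, hWall); F4b stays CONDITIONAL on `hx`; `mom := 0` conjuncts are the trivial ones; NOT «W-slot closed», NEVER
«G-an2-4 closed», NOT (CONV-C); NOT BetaPertH, NOT continuum, NOT Clay.  0 sorry, 0 cite, 0 `def … : Prop`, 0 def.
-/

noncomputable section

open Literature.MathematicalPhysics.QuantumFieldTheory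
open Literature.MathematicalPhysics.QuantumFieldTheory.Balaban1983to89
open Literature.MathematicalPhysics.QuantumFieldTheory.Balaban1983to89.Beta
open ExpKernelCalculus (MKer)
open OneStepResolventKernel (Fib LocStencil)
open OneStepKernelFamily (KInvStep)
open StepJetData (mfNeg)
open BalabanStepJetsSucc (mmRead wE e3Of)
open BalabanCompositeJets (LocStencil₂)
open SecondOrderResponse (W2SymOfK LocStencilFM)
open BalabanStepW2 (Spure M1 M2Of K3OfK)
open AveragingMixedJetTables (vh₂S)
open Summit.QuantumFields.BalabanUV.Beta.HessKerDressedUnits (unitK unitS)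
open Summit.QuantumFields.BalabanUV.Beta.SecondOrderUnits (unitM unitM₂)
open Summit.QuantumFields.BalabanUV.Beta.GAN24.CombesThomas (sfStep smStep UnitDecayK CauchyDecayK)
open Summit.QuantumFields.BalabanUV.Beta.GAN24.StencilSlotOfE3 (one_le_of_two_le)
open Summit.QuantumFields.BalabanUV.Beta.GAN24.SpureUnitDrift (e3ShapeDrift_three)
open Summit.QuantumFields.BalabanUV.Beta.GAN24.KSlotAssembly (convCKWall_holds)
open Summit.QuantumFields.BalabanUV.Beta.GAN24.T2SlotUnits (locStencil₂_vh₂S)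
open Summit.QuantumFields.BalabanUV.Beta.GAN24.T2RecursionAffine (lin4)
open Summit.QuantumFields.BalabanUV.Beta.GAN24.W3SourceRowsBorder (hb_border hf_border)

namespace Summit.QuantumFields.BalabanUV.Beta.GAN24.W3SourceRowsEnd

/-! ## §1 The base-root border `vh₂S d Lc`, generic `d` -/

section Generic

variable {d : ℕ} {Lc : ℕ} [NeZero Lc]

/-- **ROW W3-F4a IN THE TREE END's LITERAL INSTANTIATION (`vh₂S d Lc`), `mom := 0`, EVERY INPUT RATE `δin ≤ δ*`, generic `d`** [folklore
packaging]: `W3SourceRowsBorder.hb_border` at `B := vh₂S d Lc` (`hB` by leaf-19's `locStencil₂_vh₂S`); left: K-slot decay half, «E3Shape», the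
mixFF shape. For `δin ≤ δ*` the inner statement is the `hb` of `WSlotT2OfPieces.t2Shape_of_rows` at `mom := fun _ ↦ 0`. -/
theorem hb_base (hLc : 1 ≤ Lc) {C δ : ℝ} (hK : UnitDecayK d Lc (sfStep Lc) (smStep d Lc) C δ) (hδ : 0 < δ)
    {cE cVH cΛ C₃ δ₃ : ℝ}
    (hE3 : ∀ j : ℕ, LocStencil (unitS (sfStep Lc (j + 1)) (smStep d Lc (j + 1))
      (fun κ u => (cE * wE d Lc (j + 1)) • e3Of d Lc cE cVH cΛ (j + 1) κ u)) C₃ δ₃) (hδ₃ : 0 < δ₃)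
    {mixFF : Fin (d + 1) → (Fin (d + 1) → ℤ) → Fin (d + 1) → (Fin (d + 1) → ℤ) → MKer (d + 1) (Fib d)} {CM₂ δ₄ : ℝ}
    (hmix : LocStencilFM Lc mixFF CM₂ δ₄) (hδ₄ : 0 < δ₄)
    (hfm : ∀ κ u ρ w x z (α μ' : Fin (d + 1)), mixFF κ u ρ w x z (Sum.inl α) (Sum.inr μ') = 0)
    (hm : ∀ κ u ρ w x z (μ' : Fin (d + 1)) (b : Fib d), mixFF κ u ρ w x z (Sum.inr μ') b = 0) (cE₂ cB : ℝ) :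
    ∃ Cb δb : ℝ, 0 ≤ Cb ∧ 0 < δb ∧ ∀ ⦃δin : ℝ⦄, δin ≤ δb → ∀ m, LocStencil₂ (fun κ u κ' u' =>
      (cE₂ * (Lc : ℝ) ^ (2 * (d + 1))) •
          mmRead Lc (K3OfK (unitK (sfStep Lc m) (smStep d Lc m) (KInvStep (d := d) Lc m)) Lc
            (unitS (sfStep Lc m) (smStep d Lc m) (Spure d Lc cE cVH cΛ m)) (unitM (sfStep Lc m) (smStep d Lc m) (M1 d Lc cΛ m))
            (W2SymOfK (unitK (sfStep Lc m) (smStep d Lc m) (KInvStep (d := d) Lc m)) Lc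
              (unitS (sfStep Lc m) (smStep d Lc m) (Spure d Lc cE cVH cΛ m)) (unitM (sfStep Lc m) (smStep d Lc m) (M1 d Lc cΛ m)) 0
              (unitM₂ (sfStep Lc m) (smStep d Lc m) (M2Of d Lc mixFF m))) κ u κ' u')
        + cB • mfNeg ((vh₂S d Lc) κ u κ' u')) Cb δin ∧ 0 ≤ Cb :=
  hb_border hLc hK hδ hE3 hδ₃ hmix hδ₄ hfm hm ⟨_, 1, one_pos, locStencil₂_vh₂S hLc zero_le_one⟩ cE₂ cB

/-- **ROW W3-F4b IN THE TREE END's LITERAL INSTANTIATION (`vh₂S d Lc`), `mom := 0`, EVERY INPUT RATE `δin ≤ δ*`, generic `d`, AS A FUNCTION OF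
THE TOWER's UNIFORM SHAPE** [folklore packaging]: `W3SourceRowsBorder.hf_border` at `B := vh₂S d Lc`; left: the K-slot rows, «E3Shape» ∧
«E3Drift», the mixFF shape and `hx` (= «T2Shape» at `x := T♮`, END #1's output; ref2 R53-3). For `δin ≤ δ*` the inner statement is the `hf` of
`WSlotT2OfPieces.t2Drift_of_rows` at `mom := fun _ ↦ 0`, forcing with `lin4` BY NAME (leaf-01's F1b text at the tower `x`). -/
theorem hf_base (hLc : 1 ≤ Lc) {C δ cK θK : ℝ} (hK : UnitDecayK d Lc (sfStep Lc) (smStep d Lc) C δ)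
    (hKall : CauchyDecayK d Lc (sfStep Lc) (smStep d Lc) cK θK δ) (hδ : 0 < δ) (hθK0 : 0 ≤ θK) (hθK1 : θK < 1)
    {cE cVH cΛ C₃ c₃ θ₃ δ₃ : ℝ}
    (hE3 : ∀ j : ℕ, LocStencil (unitS (sfStep Lc (j + 1)) (smStep d Lc (j + 1))
      (fun κ u => (cE * wE d Lc (j + 1)) • e3Of d Lc cE cVH cΛ (j + 1) κ u)) C₃ δ₃)
    (hE3d : ∀ k j : ℕ, LocStencil (fun κ u =>
        unitS (sfStep Lc (k + j + 1)) (smStep d Lc (k + j + 1))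
            (fun κ u => (cE * wE d Lc (k + j + 1)) • e3Of d Lc cE cVH cΛ (k + j + 1) κ u) κ u -
          unitS (sfStep Lc (k + 1)) (smStep d Lc (k + 1))
            (fun κ u => (cE * wE d Lc (k + 1)) • e3Of d Lc cE cVH cΛ (k + 1) κ u) κ u) (c₃ * θ₃ ^ k) δ₃)
    (hθ₃ : 0 < θ₃) (hθ₃1 : θ₃ < 1) (hδ₃ : 0 < δ₃)
    {mixFF : Fin (d + 1) → (Fin (d + 1) → ℤ) → Fin (d + 1) → (Fin (d + 1) → ℤ) → MKer (d + 1) (Fib d)} {CM₂ δ₄ : ℝ}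
    (hmix : LocStencilFM Lc mixFF CM₂ δ₄) (hδ₄ : 0 < δ₄)
    (hfm : ∀ κ u ρ w x z (α μ' : Fin (d + 1)), mixFF κ u ρ w x z (Sum.inl α) (Sum.inr μ') = 0)
    (hm : ∀ κ u ρ w x z (μ' : Fin (d + 1)) (b : Fib d), mixFF κ u ρ w x z (Sum.inr μ') b = 0) (cE₂ cB : ℝ)
    {x : ℕ → Fin (d + 1) → (Fin (d + 1) → ℤ) → Fin (d + 1) → (Fin (d + 1) → ℤ) → MKer (d + 1) (Fib d)} {C₂ δ₂ : ℝ}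
    (hx : ∀ j, LocStencil₂ (x j) C₂ δ₂) (hδ₂ : 0 < δ₂) :
    ∃ Cf θ δf : ℝ, 0 ≤ Cf ∧ 0 ≤ θ ∧ θ < 1 ∧ 0 < δf ∧ ∀ ⦃δin : ℝ⦄, δin ≤ δf → ∀ m, LocStencil₂
      ((lin4 (cE₂ * (Lc : ℝ) ^ (2 * (d + 1))) (unitK (sfStep Lc (m + 1)) (smStep d Lc (m + 1)) (KInvStep (d := d) Lc (m + 1))) Lc (x m)
          - lin4 (cE₂ * (Lc : ℝ) ^ (2 * (d + 1))) (unitK (sfStep Lc m) (smStep d Lc m) (KInvStep (d := d) Lc m)) Lc (x m))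
        + ((fun κ u κ' u' => (cE₂ * (Lc : ℝ) ^ (2 * (d + 1))) •
            mmRead Lc (K3OfK (unitK (sfStep Lc (m + 1)) (smStep d Lc (m + 1)) (KInvStep (d := d) Lc (m + 1))) Lc
              (unitS (sfStep Lc (m + 1)) (smStep d Lc (m + 1)) (Spure d Lc cE cVH cΛ (m + 1)))
              (unitM (sfStep Lc (m + 1)) (smStep d Lc (m + 1)) (M1 d Lc cΛ (m + 1)))
              (W2SymOfK (unitK (sfStep Lc (m + 1)) (smStep d Lc (m + 1)) (KInvStep (d := d) Lc (m + 1))) Lc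
                (unitS (sfStep Lc (m + 1)) (smStep d Lc (m + 1)) (Spure d Lc cE cVH cΛ (m + 1)))
                (unitM (sfStep Lc (m + 1)) (smStep d Lc (m + 1)) (M1 d Lc cΛ (m + 1))) 0
                (unitM₂ (sfStep Lc (m + 1)) (smStep d Lc (m + 1)) (M2Of d Lc mixFF (m + 1)))) κ u κ' u')
            + cB • mfNeg ((vh₂S d Lc) κ u κ' u'))
          - (fun κ u κ' u' => (cE₂ * (Lc : ℝ) ^ (2 * (d + 1))) •
            mmRead Lc (K3OfK (unitK (sfStep Lc m) (smStep d Lc m) (KInvStep (d := d) Lc m)) Lc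
              (unitS (sfStep Lc m) (smStep d Lc m) (Spure d Lc cE cVH cΛ m)) (unitM (sfStep Lc m) (smStep d Lc m) (M1 d Lc cΛ m))
              (W2SymOfK (unitK (sfStep Lc m) (smStep d Lc m) (KInvStep (d := d) Lc m)) Lc
                (unitS (sfStep Lc m) (smStep d Lc m) (Spure d Lc cE cVH cΛ m)) (unitM (sfStep Lc m) (smStep d Lc m) (M1 d Lc cΛ m)) 0
                (unitM₂ (sfStep Lc m) (smStep d Lc m) (M2Of d Lc mixFF m))) κ u κ' u')
            + cB • mfNeg ((vh₂S d Lc) κ u κ' u'))))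
      (Cf * θ ^ m) δin ∧ 0 ≤ Cf * θ ^ m :=
  hf_border hLc hK hKall hδ hθK0 hθK1 hE3 hE3d hθ₃ hθ₃1 hδ₃ hmix hδ₄ hfm hm _ cE₂ cB hx hδ₂

end Generic

/-! ## §2 `d = 3`, `Lc ≥ 2`: K-slot and S-slot BY NAME — residual hypotheses = the mixFF shape (+ the tower shape for F4b) -/

section Three

variable {Lc : ℕ} [NeZero Lc]

/-- **ROW W3-F4a IN THE TREE END's LITERAL INSTANTIATION AT `d = 3`, `Lc ≥ 2`, `mom := 0`, EVERY INPUT RATE `δin ≤ δ*` — FROM THE MIXED-TABLE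
SHAPE ALONE** [folklore packaging]: K-slot by `KSlotAssembly.convCKWall_holds`, «E3Shape» by `SpureUnitDrift.e3ShapeDrift_three`, into `hb_base`. -/
theorem hb_three (hLc : 2 ≤ Lc) (cE cVH cΛ cE₂ cB : ℝ)
    {mixFF : Fin (3 + 1) → (Fin (3 + 1) → ℤ) → Fin (3 + 1) → (Fin (3 + 1) → ℤ) → MKer (3 + 1) (Fib 3)} {CM₂ δ₄ : ℝ}
    (hmix : LocStencilFM Lc mixFF CM₂ δ₄) (hδ₄ : 0 < δ₄)
    (hfm : ∀ κ u ρ w x z (α μ' : Fin (3 + 1)), mixFF κ u ρ w x z (Sum.inl α) (Sum.inr μ') = 0)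
    (hm : ∀ κ u ρ w x z (μ' : Fin (3 + 1)) (b : Fib 3), mixFF κ u ρ w x z (Sum.inr μ') b = 0) :
    ∃ Cb δb : ℝ, 0 ≤ Cb ∧ 0 < δb ∧ ∀ ⦃δin : ℝ⦄, δin ≤ δb → ∀ m, LocStencil₂ (fun κ u κ' u' =>
      (cE₂ * (Lc : ℝ) ^ (2 * (3 + 1))) •
          mmRead Lc (K3OfK (unitK (sfStep Lc m) (smStep 3 Lc m) (KInvStep (d := 3) Lc m)) Lc
            (unitS (sfStep Lc m) (smStep 3 Lc m) (Spure 3 Lc cE cVH cΛ m)) (unitM (sfStep Lc m) (smStep 3 Lc m) (M1 3 Lc cΛ m))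
            (W2SymOfK (unitK (sfStep Lc m) (smStep 3 Lc m) (KInvStep (d := 3) Lc m)) Lc
              (unitS (sfStep Lc m) (smStep 3 Lc m) (Spure 3 Lc cE cVH cΛ m)) (unitM (sfStep Lc m) (smStep 3 Lc m) (M1 3 Lc cΛ m)) 0
              (unitM₂ (sfStep Lc m) (smStep 3 Lc m) (M2Of 3 Lc mixFF m))) κ u κ' u')
        + cB • mfNeg ((vh₂S 3 Lc) κ u κ' u')) Cb δin ∧ 0 ≤ Cb := by
  obtain ⟨C, δ, cK, θ, hδ, -, -, hK, -⟩ := convCKWall_holds (Lc := Lc) hLc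
  obtain ⟨C₃, c₃, θ₃, δ₃, -, -, hδ₃, hE3, -⟩ := e3ShapeDrift_three (Lc := Lc) hLc cE cVH cΛ
  exact hb_base (one_le_of_two_le hLc) hK hδ hE3 hδ₃ hmix hδ₄ hfm hm cE₂ cB

/-- **ROW W3-F4b IN THE TREE END's LITERAL INSTANTIATION AT `d = 3`, `Lc ≥ 2`, `mom := 0`, EVERY INPUT RATE `δin ≤ δ*`, AS A FUNCTION OF THE
TOWER's UNIFORM SHAPE — FROM THE MIXED-TABLE SHAPE AND `hx` ALONE** [folklore packaging]: K-slot (both rows) by `KSlotAssembly.convCKWall_holds`,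
«E3Shape» ∧ «E3Drift» by `SpureUnitDrift.e3ShapeDrift_three`, into `hf_base`; CONDITIONAL on `hx` (= «T2Shape», END #1's output; ref2 R53-3 ∕
R57-3: END #3 chooses the difference tower's `δin′ ≤ δ*` AFTER END #1's output). -/
theorem hf_three (hLc : 2 ≤ Lc) (cE cVH cΛ cE₂ cB : ℝ)
    {mixFF : Fin (3 + 1) → (Fin (3 + 1) → ℤ) → Fin (3 + 1) → (Fin (3 + 1) → ℤ) → MKer (3 + 1) (Fib 3)} {CM₂ δ₄ : ℝ}
    (hmix : LocStencilFM Lc mixFF CM₂ δ₄) (hδ₄ : 0 < δ₄)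
    (hfm : ∀ κ u ρ w x z (α μ' : Fin (3 + 1)), mixFF κ u ρ w x z (Sum.inl α) (Sum.inr μ') = 0)
    (hm : ∀ κ u ρ w x z (μ' : Fin (3 + 1)) (b : Fib 3), mixFF κ u ρ w x z (Sum.inr μ') b = 0)
    {x : ℕ → Fin (3 + 1) → (Fin (3 + 1) → ℤ) → Fin (3 + 1) → (Fin (3 + 1) → ℤ) → MKer (3 + 1) (Fib 3)} {C₂ δ₂ : ℝ}
    (hx : ∀ j, LocStencil₂ (x j) C₂ δ₂) (hδ₂ : 0 < δ₂) :
    ∃ Cf θ δf : ℝ, 0 ≤ Cf ∧ 0 ≤ θ ∧ θ < 1 ∧ 0 < δf ∧ ∀ ⦃δin : ℝ⦄, δin ≤ δf → ∀ m, LocStencil₂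
      ((lin4 (cE₂ * (Lc : ℝ) ^ (2 * (3 + 1))) (unitK (sfStep Lc (m + 1)) (smStep 3 Lc (m + 1)) (KInvStep (d := 3) Lc (m + 1))) Lc (x m)
          - lin4 (cE₂ * (Lc : ℝ) ^ (2 * (3 + 1))) (unitK (sfStep Lc m) (smStep 3 Lc m) (KInvStep (d := 3) Lc m)) Lc (x m))
        + ((fun κ u κ' u' => (cE₂ * (Lc : ℝ) ^ (2 * (3 + 1))) •
            mmRead Lc (K3OfK (unitK (sfStep Lc (m + 1)) (smStep 3 Lc (m + 1)) (KInvStep (d := 3) Lc (m + 1))) Lc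
              (unitS (sfStep Lc (m + 1)) (smStep 3 Lc (m + 1)) (Spure 3 Lc cE cVH cΛ (m + 1)))
              (unitM (sfStep Lc (m + 1)) (smStep 3 Lc (m + 1)) (M1 3 Lc cΛ (m + 1)))
              (W2SymOfK (unitK (sfStep Lc (m + 1)) (smStep 3 Lc (m + 1)) (KInvStep (d := 3) Lc (m + 1))) Lc
                (unitS (sfStep Lc (m + 1)) (smStep 3 Lc (m + 1)) (Spure 3 Lc cE cVH cΛ (m + 1)))
                (unitM (sfStep Lc (m + 1)) (smStep 3 Lc (m + 1)) (M1 3 Lc cΛ (m + 1))) 0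
                (unitM₂ (sfStep Lc (m + 1)) (smStep 3 Lc (m + 1)) (M2Of 3 Lc mixFF (m + 1)))) κ u κ' u')
            + cB • mfNeg ((vh₂S 3 Lc) κ u κ' u'))
          - (fun κ u κ' u' => (cE₂ * (Lc : ℝ) ^ (2 * (3 + 1))) •
            mmRead Lc (K3OfK (unitK (sfStep Lc m) (smStep 3 Lc m) (KInvStep (d := 3) Lc m)) Lc
              (unitS (sfStep Lc m) (smStep 3 Lc m) (Spure 3 Lc cE cVH cΛ m)) (unitM (sfStep Lc m) (smStep 3 Lc m) (M1 3 Lc cΛ m))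
              (W2SymOfK (unitK (sfStep Lc m) (smStep 3 Lc m) (KInvStep (d := 3) Lc m)) Lc
                (unitS (sfStep Lc m) (smStep 3 Lc m) (Spure 3 Lc cE cVH cΛ m)) (unitM (sfStep Lc m) (smStep 3 Lc m) (M1 3 Lc cΛ m)) 0
                (unitM₂ (sfStep Lc m) (smStep 3 Lc m) (M2Of 3 Lc mixFF m))) κ u κ' u')
            + cB • mfNeg ((vh₂S 3 Lc) κ u κ' u'))))
      (Cf * θ ^ m) δin ∧ 0 ≤ Cf * θ ^ m := by
  obtain ⟨C, δ, cK, θ, hδ, hθ0, hθ1, hK, hKall⟩ := convCKWall_holds (Lc := Lc) hLc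
  obtain ⟨C₃, c₃, θ₃, δ₃, hθ₃, hθ₃1, hδ₃, hE3, hE3d⟩ := e3ShapeDrift_three (Lc := Lc) hLc cE cVH cΛ
  exact hf_base (one_le_of_two_le hLc) hK hKall hδ hθ0 hθ1 hE3 hE3d hθ₃ hθ₃1 hδ₃ hmix hδ₄ hfm hm cE₂ cB hx hδ₂

end Three

end Summit.QuantumFields.BalabanUV.Beta.GAN24.W3SourceRowsEnd

end
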